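import Mathlib
import HarnessLib

/-!
# LINE (A) `product_plus_one` (crux `MatrixDescartes`, stmt-ValiantsHypothesis-18050, V1) — W-CB engine T1: the FAST-KNEE SHELL
# «(L4′) the band set `B = {y² < κ² < b}` is an interval ⇒ `S − β` has no five zeros» (degeneracy-free, no local-max/min typing)

Owner memo `pub/ideators/val-idea-25/NOTE-idea25g3-18050-LINEA-AB-reduction.md` §24–§25 (val-idea-25 g5, T1 = E5′: ONE fast knee `β`
against a background `S` of poles and slow knees) and `pub/val-lit/lmr/NOTE-p8g17-18050-pure-2N-law.md` §6 (val-lit-p8 g17).  In θ-currency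
(`θ = x·d/dx`, window component `J = (a,b) ⊂ (0,∞)` on which `S > 0`, `θS = S₁`, `θS₁ = S₂`, `y = S₁/S`, `b = 3y² − 2S₂/S`) the zeros of
`F = S − c·q/(1+q)²` (`q = a₀x^κ`, the fast knee of rate `κ` centred at `a₀x^κ = 1`) are the level-`c` points of `E = S·(1+q)²/q`, whose critical
points are the zeros of `G♭ = S₁ + κ·T·S` (`T = (q−1)/(q+1)`), i.e. the solutions of `Λ(x) = a₀` with the EXPLICIT
`Λ := (κS − S₁)/((κS + S₁)·x^κ)` on the band `Y = {S₁² < κ²S²}`; and `θ log Λ = −κ(κ²S² − b̂)/(κ²S² − S₁²)`, `b̂ := 3S₁² − 2S·S₂ = S²b`, so `Λ`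
is antitone off `B := {x ∈ Y : κ²S² < b̂}` and monotone on `B` (memo §25 (25.3): `Λ = e^{−κΛ₀}`).  Hence:

* ★ `fastKneeShell_no_five_zeros` — if `Y ∩ J` and `B` are order-connected (three-point betweenness; `B` order-connected is the owner's located
  leaf (L4′), `Y` order-connected is located alongside it) and `G♭` vanishes on no sub-interval, then `F` has no five zeros on `J` (three monotone
  blocks of `Λ` on `Y`, all zeros of `G♭` lie in `Y`; four Rolle zeros put two in one block ⇒ an interval of zeros).  No inverse function (the
  reference family is ONE knee, whose log-slope inverts explicitly), no local-extremum typing: tangencies and inflection-type critical points of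
  `E` cost nothing — companion of ✓/⧗ `…ProductPlusOneCrossingShell` (pull aggregate as reference).

Honest framing: a conditional real-analysis shell; (L4′) and the band-connectedness are LOCATED, not proved; nothing here proves
`WronskianBudgetK3` / `OneChangeFloorK3` / the stubs / 18050 / `MatrixDescartes`; `VP ≠ VNP` is NOT proved.  No definitions, no named facts;
Mathlib only.
-/

set_option linter.dupNamespace false

namespace Summit.ValiantsHypothesis.ValiantsHypothesis.Theorems.LacunarySymmetroidMatrixDescartes

namespace ProductPlusOne

open Set
open scoped Topology

/-- ★ **THE FAST-KNEE SHELL (T1).**  θ-data `HasDerivAt S (S₁ x / x) x`, `HasDerivAt S₁ (S₂ x / x) x` and `S > 0` on `J = (a,b)`, `0 ≤ a`;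
fast knee of rate `n+1` and centre parameter `a₀ > 0`, any weight `c`.  Put `G♭ := S₁ + (n+1)·T·S` with `T = (a₀x^{n+1} − 1)/(a₀x^{n+1} + 1)`,
`Y := {x ∈ J : S₁² < (n+1)²S²}`, `b̂ := 3S₁² − 2S·S₂`, `B := {x ∈ Y : (n+1)²S² < b̂}`.  If `Y` and `B` are order-connected and `G♭` vanishes on
no sub-interval of `J`, then `F := S − c·a₀x^{n+1}/(1 + a₀x^{n+1})²` does not vanish at five points of `J`. [this file's theorem] -/
theorem fastKneeShell_no_five_zeros (n : ℕ) {a b a₀ c : ℝ} {S S₁ S₂ : ℝ → ℝ} (ha : 0 ≤ a) (ha₀ : 0 < a₀)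
    (hS : ∀ x ∈ Ioo a b, HasDerivAt S (S₁ x / x) x) (hS₁ : ∀ x ∈ Ioo a b, HasDerivAt S₁ (S₂ x / x) x)
    (hSpos : ∀ x ∈ Ioo a b, 0 < S x)
    (hY : ∀ t₁ ∈ Ioo a b, ∀ t₂ ∈ Ioo a b, ∀ t₃ ∈ Ioo a b, t₁ < t₂ → t₂ < t₃ →
      S₁ t₁ ^ 2 < ((n : ℝ) + 1) ^ 2 * S t₁ ^ 2 → S₁ t₃ ^ 2 < ((n : ℝ) + 1) ^ 2 * S t₃ ^ 2 →
      S₁ t₂ ^ 2 < ((n : ℝ) + 1) ^ 2 * S t₂ ^ 2)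
    (hB : ∀ t₁ ∈ Ioo a b, ∀ t₂ ∈ Ioo a b, ∀ t₃ ∈ Ioo a b, t₁ < t₂ → t₂ < t₃ →
      (S₁ t₁ ^ 2 < ((n : ℝ) + 1) ^ 2 * S t₁ ^ 2 ∧ ((n : ℝ) + 1) ^ 2 * S t₁ ^ 2 < 3 * S₁ t₁ ^ 2 - 2 * S t₁ * S₂ t₁) →
      (S₁ t₃ ^ 2 < ((n : ℝ) + 1) ^ 2 * S t₃ ^ 2 ∧ ((n : ℝ) + 1) ^ 2 * S t₃ ^ 2 < 3 * S₁ t₃ ^ 2 - 2 * S t₃ * S₂ t₃) →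
      ((n : ℝ) + 1) ^ 2 * S t₂ ^ 2 < 3 * S₁ t₂ ^ 2 - 2 * S t₂ * S₂ t₂)
    (hfin : ∀ c' d', a ≤ c' → c' < d' → d' ≤ b → ∃ x ∈ Ioo c' d',
      S₁ x + ((n : ℝ) + 1) * ((a₀ * x ^ (n + 1) - 1) / (a₀ * x ^ (n + 1) + 1)) * S x ≠ 0)
    {x₁ x₂ x₃ x₄ x₅ : ℝ} (h₁ : x₁ ∈ Ioo a b) (h₅ : x₅ ∈ Ioo a b)
    (h12 : x₁ < x₂) (h23 : x₂ < x₃) (h34 : x₃ < x₄) (h45 : x₄ < x₅)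
    (hz : ∀ x ∈ ({x₁, x₂, x₃, x₄, x₅} : Set ℝ), S x - c * (a₀ * x ^ (n + 1)) / (1 + a₀ * x ^ (n + 1)) ^ 2 = 0) : False := by
  set I : Set ℝ := Ioo a b with hI
  have hIc : I.OrdConnected := ordConnected_Ioo
  set k : ℝ := (n : ℝ) + 1 with hk
  have hk0 : 0 < k := by positivity
  have hxpos : ∀ x ∈ I, 0 < x := fun x hx => ha.trans_lt hx.1
  -- the fast knee's variable `q = a₀ x^{n+1}` and `T = (q-1)/(q+1)`
  set q : ℝ → ℝ := fun x => a₀ * x ^ (n + 1) with hqdef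
  have hqpos : ∀ x ∈ I, 0 < q x := fun x hx => mul_pos ha₀ (pow_pos (hxpos x hx) _)
  have hq : ∀ x ∈ I, HasDerivAt q (k * q x / x) x := by
    intro x hx
    have hx0 : x ≠ 0 := (hxpos x hx).ne'
    have h := (hasDerivAt_pow (n + 1) x).const_mul a₀
    refine h.congr_deriv ?_
    simp only [hqdef, hk]
    push_cast
    rw [pow_succ]
    field_simp
  set T : ℝ → ℝ := fun x => (q x - 1) / (q x + 1) with hTdef
  set Gf : ℝ → ℝ := fun x => S₁ x + k * T x * S x with hGfdef
  -- `E = S (1+q)²/q` and its θ-derivative `Gf · (1+q)²/q`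
  set hf : ℝ → ℝ := fun x => (1 + q x) ^ 2 / q x with hhfdef
  have hhfpos : ∀ x ∈ I, 0 < hf x := fun x hx => div_pos (by nlinarith [hqpos x hx]) (hqpos x hx)
  have hhf : ∀ x ∈ I, HasDerivAt hf (k * T x * hf x / x) x := by
    intro x hx
    have hx0 : x ≠ 0 := (hxpos x hx).ne'
    have hq0 : q x ≠ 0 := (hqpos x hx).ne'
    have hq1 : q x + 1 ≠ 0 := by nlinarith [hqpos x hx]
    have hnum : HasDerivAt (fun x => (1 + q x) ^ 2) (2 * (1 + q x) * (k * q x / x)) x := by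
      have := ((hq x hx).const_add 1).pow 2
      refine this.congr_deriv ?_
      push_cast
      ring
    refine ((hnum.div (hq x hx) hq0)).congr_deriv ?_
    simp only [hhfdef, hTdef]
    field_simp
    ring
  set E : ℝ → ℝ := fun x => S x * hf x with hEdef
  have hE : ∀ x ∈ I, HasDerivAt E (Gf x * hf x / x) x := by
    intro x hx
    have hx0 : x ≠ 0 := (hxpos x hx).ne'
    refine ((hS x hx).mul (hhf x hx)).congr_deriv ?_
    simp only [hGfdef]
    field_simp
  -- zeros of `F` are level points of `E`
  have hElevel : ∀ x ∈ I, S x - c * (a₀ * x ^ (n + 1)) / (1 + a₀ * x ^ (n + 1)) ^ 2 = 0 → E x = c := by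
    intro x hx hFx
    have hq0 : q x ≠ 0 := (hqpos x hx).ne'
    have hq1 : (1 + q x) ≠ 0 := by nlinarith [hqpos x hx]
    have : S x = c * q x / (1 + q x) ^ 2 := by
      have := hFx; simp only [hqdef] at this ⊢; linarith
    simp only [hEdef, hhfdef, this]
    field_simp
  -- Rolle: four zeros of `Gf`
  have h₂ : x₂ ∈ I := ⟨h₁.1.trans h12, h23.trans (h34.trans (h45.trans h₅.2))⟩
  have h₃ : x₃ ∈ I := ⟨h₂.1.trans h23, h34.trans (h45.trans h₅.2)⟩
  have h₄ : x₄ ∈ I := ⟨h₃.1.trans h34, h45.trans h₅.2⟩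
  have hEeq : ∀ x ∈ ({x₁, x₂, x₃, x₄, x₅} : Set ℝ), x ∈ I → E x = c := fun x hx hxI => hElevel x hxI (hz x hx)
  have rolle : ∀ {p r : ℝ}, p ∈ I → r ∈ I → p < r → E p = c → E r = c → ∃ t ∈ Ioo p r, Gf t = 0 := by
    intro p r hp hr hpr hEp hEr
    have hsub : Icc p r ⊆ I := hIc.out hp hr
    have hcont : ContinuousOn E (Icc p r) := fun t ht => (hE t (hsub ht)).continuousAt.continuousWithinAt
    obtain ⟨t, ht, ht'⟩ := exists_hasDerivAt_eq_zero hpr hcont (by rw [hEp, hEr])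
      (fun t ht => hE t (hsub (Ioo_subset_Icc_self ht)))
    have htI : t ∈ I := hsub (Ioo_subset_Icc_self ht)
    refine ⟨t, ht, ?_⟩
    have hne : hf t / t ≠ 0 := div_ne_zero (hhfpos t htI).ne' (hxpos t htI).ne'
    have : Gf t * (hf t / t) = 0 := by rw [← mul_div_assoc]; exact ht'
    exact (mul_eq_zero.1 this).resolve_right hne
  obtain ⟨c₁, hc₁, hg₁⟩ := rolle h₁ h₂ h12 (hEeq _ (by simp) h₁) (hEeq _ (by simp) h₂)
  obtain ⟨c₂, hc₂, hg₂⟩ := rolle h₂ h₃ h23 (hEeq _ (by simp) h₂) (hEeq _ (by simp) h₃)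
  obtain ⟨c₃, hc₃, hg₃⟩ := rolle h₃ h₄ h34 (hEeq _ (by simp) h₃) (hEeq _ (by simp) h₄)
  obtain ⟨c₄, hc₄, hg₄⟩ := rolle h₄ h₅ h45 (hEeq _ (by simp) h₄) (hEeq _ (by simp) h₅)
  have hc₁I : c₁ ∈ I := ⟨h₁.1.trans hc₁.1, hc₁.2.trans h₂.2⟩
  have hc₂I : c₂ ∈ I := ⟨h₂.1.trans hc₂.1, hc₂.2.trans h₃.2⟩
  have hc₃I : c₃ ∈ I := ⟨h₃.1.trans hc₃.1, hc₃.2.trans h₄.2⟩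
  have hc₄I : c₄ ∈ I := ⟨h₄.1.trans hc₄.1, hc₄.2.trans h₅.2⟩
  have hc12 : c₁ < c₂ := hc₁.2.trans hc₂.1
  have hc23 : c₂ < c₃ := hc₂.2.trans hc₃.1
  have hc34 : c₃ < c₄ := hc₃.2.trans hc₄.1
  -- the band `Y`, the set `B`, the explicit `Λ`
  set Y : Set ℝ := {x | x ∈ I ∧ S₁ x ^ 2 < k ^ 2 * S x ^ 2} with hYdef
  set Bs : Set ℝ := {x | x ∈ Y ∧ k ^ 2 * S x ^ 2 < 3 * S₁ x ^ 2 - 2 * S x * S₂ x} with hBsdef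
  have hY_sub : Y ⊆ I := fun x hx => hx.1
  have hBs_sub : Bs ⊆ Y := fun x hx => hx.1
  -- `|T| < 1`, hence every zero of `Gf` lies in `Y`
  have hT_sq : ∀ x ∈ I, T x ^ 2 < 1 := by
    intro x hx
    have hq' := hqpos x hx
    have h1 : q x + 1 ≠ 0 := by linarith
    rw [hTdef]
    rw [div_pow, div_lt_one (by positivity)]
    nlinarith
  have hzero_Y : ∀ x ∈ I, Gf x = 0 → x ∈ Y := by
    intro x hx hG
    refine ⟨hx, ?_⟩
    have hS' := hSpos x hx
    have : S₁ x = -(k * T x * S x) := by simp only [hGfdef] at hG; linarith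
    rw [this]
    have hT := hT_sq x hx
    have : (-(k * T x * S x)) ^ 2 = T x ^ 2 * (k ^ 2 * S x ^ 2) := by ring
    rw [this]
    have hkS : 0 < k ^ 2 * S x ^ 2 := by positivity
    calc T x ^ 2 * (k ^ 2 * S x ^ 2) < 1 * (k ^ 2 * S x ^ 2) := by
          exact mul_lt_mul_of_pos_right hT hkS
      _ = k ^ 2 * S x ^ 2 := one_mul _
  -- on `Y`: `kS + S₁ > 0` and `kS − S₁ > 0`
  have hband : ∀ x ∈ Y, 0 < k * S x + S₁ x ∧ 0 < k * S x - S₁ x := by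
    intro x hx
    have hS' := hSpos x hx.1
    have hkS : 0 < k * S x := mul_pos hk0 hS'
    have h2 : S₁ x ^ 2 < (k * S x) ^ 2 := by rw [mul_pow]; exact hx.2
    have habs : |S₁ x| < k * S x := abs_lt_of_sq_lt_sq h2 hkS.le
    constructor <;> [linarith [(abs_lt.1 habs).1]; linarith [(abs_lt.1 habs).2]]
  set DEN : ℝ → ℝ := fun x => (k * S x + S₁ x) * x ^ (n + 1) with hDENdef
  set NUM : ℝ → ℝ := fun x => k * S x - S₁ x with hNUMdef
  set Λ : ℝ → ℝ := fun x => NUM x / DEN x with hΛdef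
  have hDENpos : ∀ x ∈ Y, 0 < DEN x := fun x hx => mul_pos (hband x hx).1 (pow_pos (hxpos x hx.1) _)
  -- `Gf = 0 ↔ Λ = a₀` on `Y`
  have hGf_iff : ∀ x ∈ Y, Gf x = 0 ↔ Λ x = a₀ := by
    intro x hx
    have hD := (hDENpos x hx).ne'
    have hq1 : q x + 1 ≠ 0 := by linarith [hqpos x hx.1]
    have key : Gf x * (q x + 1) = a₀ * DEN x - NUM x := by
      have hq1' : a₀ * x ^ (n + 1) + 1 ≠ 0 := by simpa [hqdef] using hq1
      have e1 : Gf x * (q x + 1) = S₁ x * (a₀ * x ^ (n + 1) + 1) + k * (a₀ * x ^ (n + 1) - 1) * S x := by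
        simp only [hGfdef, hTdef, hqdef]
        rw [add_mul, mul_assoc k, mul_comm (_ / _) (S x), ← mul_assoc, mul_assoc (k * S x), div_mul_cancel₀ _ hq1']
        ring
      rw [e1]
      simp only [hNUMdef, hDENdef]
      ring
    rw [hΛdef]
    rw [div_eq_iff hD]
    constructor
    · intro h
      have : a₀ * DEN x - NUM x = 0 := by rw [← key, h, zero_mul]
      linarith
    · intro h
      have : Gf x * (q x + 1) = 0 := by rw [key, h]; ring
      exact (mul_eq_zero.1 this).resolve_right hq1
  -- derivative of `Λ` and its sign
  set Λ' : ℝ → ℝ := fun x => x ^ (n + 1) * (k * ((3 * S₁ x ^ 2 - 2 * S x * S₂ x) - k ^ 2 * S x ^ 2)) / (x * DEN x ^ 2)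
    with hΛ'def
  have hΛ : ∀ x ∈ Y, HasDerivAt Λ (Λ' x) x := by
    intro x hx
    have hxI := hx.1
    have hx0 : x ≠ 0 := (hxpos x hxI).ne'
    have hD := (hDENpos x hx).ne'
    have hN : HasDerivAt NUM ((k * S₁ x - S₂ x) / x) x := by
      have := ((hS x hxI).const_mul k).sub (hS₁ x hxI)
      refine this.congr_deriv ?_
      field_simp
    have hDd : HasDerivAt DEN (((k * S₁ x + S₂ x) / x) * x ^ (n + 1) + (k * S x + S₁ x) * (((n + 1 : ℕ) : ℝ) * x ^ n)) x := by
      have h1 : HasDerivAt (fun x => k * S x + S₁ x) ((k * S₁ x + S₂ x) / x) x := by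
        have := ((hS x hxI).const_mul k).add (hS₁ x hxI)
        refine this.congr_deriv ?_
        field_simp
      exact h1.mul (hasDerivAt_pow (n + 1) x)
    refine ((hN.div hDd hD)).congr_deriv ?_
    simp only [hΛ'def, hDENdef, hNUMdef, hk]
    push_cast
    field_simp
    ring
  have hΛ'_sign_pos : ∀ x ∈ Bs, 0 < Λ' x := by
    intro x hx
    have hxY := hx.1
    have hxp := hxpos x hxY.1
    have hD := hDENpos x hxY
    have hcore : 0 < (3 * S₁ x ^ 2 - 2 * S x * S₂ x) - k ^ 2 * S x ^ 2 := by linarith [hx.2]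
    simp only [hΛ'def]
    positivity
  have hΛ'_sign_nonpos : ∀ x ∈ Y, x ∉ Bs → Λ' x ≤ 0 := by
    intro x hx hnot
    have hxp := hxpos x hx.1
    have hD := hDENpos x hx
    have hcore : (3 * S₁ x ^ 2 - 2 * S x * S₂ x) - k ^ 2 * S x ^ 2 ≤ 0 := by
      by_contra h
      push Not at h
      exact hnot ⟨hx, by linarith⟩
    simp only [hΛ'def]
    apply div_nonpos_of_nonpos_of_nonneg
    · exact mul_nonpos_of_nonneg_of_nonpos (pow_pos hxp _).le (mul_nonpos_of_nonneg_of_nonpos hk0.le hcore)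
    · positivity
  -- the three blocks inside `Y`
  set A₁ : Set ℝ := {x | x ∈ Y ∧ ∀ j ∈ Bs, x < j} with hA₁def
  set A₂ : Set ℝ := {x | x ∈ Y ∧ (∃ j ∈ Bs, j < x) ∧ x ∉ Bs} with hA₂def
  have hA₁_sub : A₁ ⊆ Y := fun x hx => hx.1
  have hA₂_sub : A₂ ⊆ Y := fun x hx => hx.1
  have hcover : ∀ x ∈ Y, x ∈ A₁ ∨ x ∈ Bs ∨ x ∈ A₂ := by
    intro x hx
    by_cases hxB : x ∈ Bs
    · exact Or.inr (Or.inl hxB)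
    by_cases hlow : ∀ j ∈ Bs, x < j
    · exact Or.inl ⟨hx, hlow⟩
    · push Not at hlow
      obtain ⟨j, hj, hjx⟩ := hlow
      refine Or.inr (Or.inr ⟨hx, ⟨j, hj, lt_of_le_of_ne hjx ?_⟩, hxB⟩)
      rintro rfl
      exact hxB hj
  have hY_conn : ∀ {u v t}, u ∈ Y → v ∈ Y → u ≤ t → t ≤ v → t ∈ Y := by
    intro u v t hu hv hut htv
    rcases hut.eq_or_lt with rfl | hut'
    · exact hu
    rcases htv.eq_or_lt with rfl | htv'
    · exact hv
    have htI : t ∈ I := hIc.out hu.1 hv.1 ⟨hut, htv⟩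
    exact ⟨htI, hY u hu.1 t htI v hv.1 hut' htv' hu.2 hv.2⟩
  have hBs_conn : ∀ {u v t}, u ∈ Bs → v ∈ Bs → u ≤ t → t ≤ v → t ∈ Bs := by
    intro u v t hu hv hut htv
    rcases hut.eq_or_lt with rfl | hut'
    · exact hu
    rcases htv.eq_or_lt with rfl | htv'
    · exact hv
    have htI : t ∈ I := hIc.out hu.1.1 hv.1.1 ⟨hut, htv⟩
    have htY : t ∈ Y := hY_conn hu.1 hv.1 hut htv
    exact ⟨htY, hB u hu.1.1 t htI v hv.1.1 hut' htv' ⟨hu.1.2, hu.2⟩ ⟨hv.1.2, hv.2⟩⟩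
  have hA₁_conn : ∀ {u v t}, u ∈ A₁ → v ∈ A₁ → u ≤ t → t ≤ v → t ∈ A₁ := by
    intro u v t hu hv hut htv
    exact ⟨hY_conn hu.1 hv.1 hut htv, fun j hj => lt_of_le_of_lt htv (hv.2 j hj)⟩
  have hA₂_conn : ∀ {u v t}, u ∈ A₂ → v ∈ A₂ → u ≤ t → t ≤ v → t ∈ A₂ := by
    intro u v t hu hv hut htv
    have htY : t ∈ Y := hY_conn hu.1 hv.1 hut htv
    obtain ⟨j, hj, hju⟩ := hu.2.1
    refine ⟨htY, ⟨j, hj, lt_of_lt_of_le hju hut⟩, fun htB => ?_⟩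
    exact hu.2.2 (hBs_conn hj htB hju.le hut)
  have hBs_oc : Bs.OrdConnected := ⟨fun u hu v hv t ht => hBs_conn hu hv ht.1 ht.2⟩
  have hA₁_oc : A₁.OrdConnected := ⟨fun u hu v hv t ht => hA₁_conn hu hv ht.1 ht.2⟩
  have hA₂_oc : A₂.OrdConnected := ⟨fun u hu v hv t ht => hA₂_conn hu hv ht.1 ht.2⟩
  -- monotonicity of `Λ` on the blocks
  have hΛcont : ∀ {Bk : Set ℝ}, Bk ⊆ Y → ContinuousOn Λ Bk := fun hB t ht =>
    (hΛ t (hB ht)).continuousAt.continuousWithinAt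
  have hΛwithin : ∀ {Bk : Set ℝ}, Bk ⊆ Y → ∀ t ∈ interior Bk, HasDerivWithinAt Λ (Λ' t) (interior Bk) t :=
    fun hB t ht => (hΛ t (hB (interior_subset ht))).hasDerivWithinAt
  have hΛ_Bs : MonotoneOn Λ Bs :=
    monotoneOn_of_hasDerivWithinAt_nonneg hBs_oc.convex (hΛcont hBs_sub) (hΛwithin hBs_sub)
      (fun t ht => (hΛ'_sign_pos t (interior_subset ht)).le)
  have hΛ_A₁ : AntitoneOn Λ A₁ :=
    antitoneOn_of_hasDerivWithinAt_nonpos hA₁_oc.convex (hΛcont hA₁_sub) (hΛwithin hA₁_sub)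
      (fun t ht => by
        have htA := interior_subset (s := A₁) ht
        exact hΛ'_sign_nonpos t htA.1 (fun htB => lt_irrefl t (htA.2 t htB)))
  have hΛ_A₂ : AntitoneOn Λ A₂ :=
    antitoneOn_of_hasDerivWithinAt_nonpos hA₂_oc.convex (hΛcont hA₂_sub) (hΛwithin hA₂_sub)
      (fun t ht => by
        have htA := interior_subset (s := A₂) ht
        exact hΛ'_sign_nonpos t htA.1 htA.2.2)
  -- two zeros of `Gf` in one block force an interval of zeros: contradiction with `hfin`
  have hblock : ∀ {Bk : Set ℝ}, Bk ⊆ Y → (MonotoneOn Λ Bk ∨ AntitoneOn Λ Bk) →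
      (∀ {u v t}, u ∈ Bk → v ∈ Bk → u ≤ t → t ≤ v → t ∈ Bk) →
      ∀ {u v}, u ∈ Bk → v ∈ Bk → u < v → Gf u = 0 → Gf v = 0 → False := by
    intro Bk hBk hΛB hconn u v hu hv huv hgu hgv
    have hΛu : Λ u = a₀ := (hGf_iff u (hBk hu)).1 hgu
    have hΛv : Λ v = a₀ := (hGf_iff v (hBk hv)).1 hgv
    obtain ⟨t, ht, hne⟩ := hfin u v (hBk hu).1.1.le huv (hBk hv).1.2.le
    have htB : t ∈ Bk := hconn hu hv ht.1.le ht.2.le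
    have hΛt : Λ t = a₀ := by
      rcases hΛB with h | h
      · exact le_antisymm (by simpa [hΛv] using h htB hv ht.2.le) (by simpa [hΛu] using h hu htB ht.1.le)
      · exact le_antisymm (by simpa [hΛu] using h hu htB ht.1.le) (by simpa [hΛv] using h htB hv ht.2.le)
    have : Gf t = 0 := (hGf_iff t (hBk htB)).2 hΛt
    exact hne (by simpa [hGfdef, hTdef, hqdef, hk] using this)
  -- order of the blocks: `A₁ < Bs < A₂`
  have hBs_not_A₁ : ∀ {u v}, u ∈ Bs → u < v → v ∉ A₁ := fun hu huv hv =>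
    lt_irrefl _ ((hv.2 _ hu).trans huv)
  have hA₂_not_A₁ : ∀ {u v}, u ∈ A₂ → u < v → v ∉ A₁ := fun hu huv hv => by
    obtain ⟨j, hj, hju⟩ := hu.2.1
    exact lt_irrefl _ (((hv.2 j hj).trans hju).trans huv)
  have hA₂_not_Bs : ∀ {u v}, u ∈ A₂ → u < v → v ∉ Bs := fun hu huv hv => by
    obtain ⟨j, hj, hju⟩ := hu.2.1
    exact hu.2.2 (hBs_conn hj hv hju.le huv.le)
  have hafter_Bs : ∀ {u v}, u ∈ Bs → u < v → v ∈ Y → v ∈ Bs ∨ v ∈ A₂ := fun hu huv hvY => by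
    rcases hcover _ hvY with hv | hv | hv
    · exact absurd hv (hBs_not_A₁ hu huv)
    · exact Or.inl hv
    · exact Or.inr hv
  have hafter_A₂ : ∀ {u v}, u ∈ A₂ → u < v → v ∈ Y → v ∈ A₂ := fun hu huv hvY => by
    rcases hcover _ hvY with hv | hv | hv
    · exact absurd hv (hA₂_not_A₁ hu huv)
    · exact absurd hv (hA₂_not_Bs hu huv)
    · exact hv
  -- the four Rolle zeros lie in `Y`
  have hc₁Y := hzero_Y c₁ hc₁I hg₁
  have hc₂Y := hzero_Y c₂ hc₂I hg₂
  have hc₃Y := hzero_Y c₃ hc₃I hg₃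
  have hc₄Y := hzero_Y c₄ hc₄I hg₄
  have same_A₁ := fun {u v : ℝ} (hu : u ∈ A₁) (hv : v ∈ A₁) (huv : u < v) (hgu : Gf u = 0) (hgv : Gf v = 0) =>
    hblock hA₁_sub (Or.inr hΛ_A₁) (fun hu hv hut htv => hA₁_conn hu hv hut htv) hu hv huv hgu hgv
  have same_Bs := fun {u v : ℝ} (hu : u ∈ Bs) (hv : v ∈ Bs) (huv : u < v) (hgu : Gf u = 0) (hgv : Gf v = 0) =>
    hblock hBs_sub (Or.inl hΛ_Bs) (fun hu hv hut htv => hBs_conn hu hv hut htv) hu hv huv hgu hgv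
  have same_A₂ := fun {u v : ℝ} (hu : u ∈ A₂) (hv : v ∈ A₂) (huv : u < v) (hgu : Gf u = 0) (hgv : Gf v = 0) =>
    hblock hA₂_sub (Or.inr hΛ_A₂) (fun hu hv hut htv => hA₂_conn hu hv hut htv) hu hv huv hgu hgv
  have fromBs : ∀ {u v w : ℝ}, u ∈ Bs → v ∈ Y → w ∈ Y → u < v → v < w →
      Gf u = 0 → Gf v = 0 → Gf w = 0 → False := by
    intro u v w hu hvY hwY huv hvw hgu hgv hgw
    rcases hafter_Bs hu huv hvY with hv | hv
    · exact same_Bs hu hv huv hgu hgv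
    · exact same_A₂ hv (hafter_A₂ hv hvw hwY) hvw hgv hgw
  rcases hcover c₁ hc₁Y with k₁ | k₁ | k₁
  · rcases hcover c₂ hc₂Y with k₂ | k₂ | k₂
    · exact same_A₁ k₁ k₂ hc12 hg₁ hg₂
    · exact fromBs k₂ hc₃Y hc₄Y hc23 hc34 hg₂ hg₃ hg₄
    · exact same_A₂ k₂ (hafter_A₂ k₂ hc23 hc₃Y) hc23 hg₂ hg₃
  · exact fromBs k₁ hc₂Y hc₃Y hc12 hc23 hg₁ hg₂ hg₃
  · exact same_A₂ k₁ (hafter_A₂ k₁ hc12 hc₂Y) hc12 hg₁ hg₂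

end ProductPlusOne

end Summit.ValiantsHypothesis.ValiantsHypothesis.Theorems.LacunarySymmetroidMatrixDescartes
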